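import Mathlib.RingTheory.FinitePresentation
import Mathlib.RingTheory.Localization.Away.AdjoinRoot
import Mathlib.RingTheory.Localization.Ideal
import Mathlib.RingTheory.IntegralClosure.IsIntegralClosure.Basic
import HarnessLib

/-!
# A finite algebra finitely presented over an open is a quotient of a finite finitely presented
# algebra, isomorphically over the open

Topic: `Literature/RingTheory/Localization`. Let `R → B` be a finite ring map and
`g₁, …, g_s ∈ R` such that each localisation `R[1/gᵢ] → B[1/gᵢ]` is of finite presentation.
Then there are a finite AND finitely presented `R`-algebra `B'` and a surjection `B' → B` of
`R`-algebras whose kernel is killed by a power of every `gᵢ` — so that `Spec B → Spec B'` is a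
closed immersion inducing an isomorphism over `⋃ D(gᵢ)`. This is the reduction "we may replace
`𝓕` by a finitely presented module with the same restriction to `U`" in the proof of Stacks,
Tag 0810 (¶1), in the form needed for finite schemes over a base (Raynaud–Gruson 1971,
Première partie, 5.2): write `B = R[x₁, …, xₙ]/J`; the monic equations of the (integral)
generators give an ideal `J₀ ⊆ J` of finite type with `R[x]/J₀` finite, and over each `D(gᵢ)`
the kernel of the surjection `R[x][1/gᵢ] → B[1/gᵢ]` of finitely presented `R`-algebras is
finitely generated (Stacks, Tag 00R2), by finitely many elements of `J` after clearing
denominators; `B' = R[x]/(J₀ + these)`.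

* `exists_fg_le_ker_finite_quotient` — the monic relations;
* `exists_finset_ker_smul_mem_span` — finitely many relations generate the kernel over `D(g)`;
* `exists_finite_finitePresentation_surjective` — **the finite finitely presented hull.**

## References

* The Stacks Project, Tag 0810 (proof, ¶1), Tag 00R2, Tag 0564. [StacksProject]
* M. Raynaud, L. Gruson, *Critères de platitude et de projectivité*, Invent. Math. 13 (1971),
  Première partie, 5.2. [RaynaudGruson1971]
-/

namespace Literature.RingTheory.Localization

universe u v

open Polynomial in
/-- **Monic relations.** For an `R`-algebra map `F : R[x₁, …, xₙ] → B` into a finite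
`R`-algebra there is an ideal `J₀ ⊆ ker F` of finite type — generated by `pₖ(xₖ)`, `pₖ` a monic
equation of the integral element `F(xₖ)` — such that `R[x]/J` is a finite `R`-module for every
ideal `J ⊇ J₀`. [cite: StacksProject, Tag 0564 (proof)] -/
theorem exists_fg_le_ker_finite_quotient {R : Type u} [CommRing R] {B : Type v} [CommRing B]
    [Algebra R B] [Module.Finite R B] {n : ℕ} (F : MvPolynomial (Fin n) R →ₐ[R] B) :
    ∃ J₀ : Ideal (MvPolynomial (Fin n) R), J₀.FG ∧ J₀ ≤ RingHom.ker F.toRingHom ∧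
      ∀ J : Ideal (MvPolynomial (Fin n) R), J₀ ≤ J →
        Module.Finite R (MvPolynomial (Fin n) R ⧸ J) := by
  classical
  have hint : ∀ k : Fin n, IsIntegral R (F (MvPolynomial.X k)) := fun k =>
    Algebra.IsIntegral.isIntegral _
  choose p hpm hp0 using hint
  let P : Fin n → MvPolynomial (Fin n) R := fun k =>
    Polynomial.aeval (MvPolynomial.X k : MvPolynomial (Fin n) R) (p k)
  refine ⟨Ideal.span (Set.range P), ⟨Finset.univ.image P, by simp⟩, ?_, fun J hJ => ?_⟩
  · rw [Ideal.span_le]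
    rintro _ ⟨k, rfl⟩
    change F (Polynomial.aeval (MvPolynomial.X k : MvPolynomial (Fin n) R) (p k)) = 0
    rw [← Polynomial.aeval_algHom_apply, Polynomial.aeval_def]
    exact hp0 k
  · -- `R[x]/J` is of finite type and integral, hence finite
    haveI : Algebra.FiniteType R (MvPolynomial (Fin n) R ⧸ J) :=
      Algebra.FiniteType.of_surjective (Ideal.Quotient.mkₐ R J) Ideal.Quotient.mk_surjective
    have hX : ∀ k : Fin n, IsIntegral R (Ideal.Quotient.mkₐ R J (MvPolynomial.X k)) := fun k => by
      refine ⟨p k, hpm k, ?_⟩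
      rw [← Polynomial.aeval_def, Polynomial.aeval_algHom_apply]
      exact Ideal.Quotient.eq_zero_iff_mem.mpr (hJ (Ideal.subset_span ⟨k, rfl⟩))
    haveI : Algebra.IsIntegral R (MvPolynomial (Fin n) R ⧸ J) := by
      refine ⟨fun q => ?_⟩
      obtain ⟨a, rfl⟩ := Ideal.Quotient.mk_surjective q
      change IsIntegral R (Ideal.Quotient.mkₐ R J a)
      induction a using MvPolynomial.induction_on with
      | C r =>
        rw [MvPolynomial.algHom_C]
        exact isIntegral_algebraMap
      | add p q hp hq =>
        rw [map_add]
        exact hp.add hq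
      | mul_X p k hp =>
        rw [map_mul]
        exact hp.mul (hX k)
    exact Algebra.IsIntegral.finite

/-- **Finitely many relations generate the kernel over `D(g)`.** Let `A` be a finitely
presented `R`-algebra, `F : A → B` a surjection of `R`-algebras and `g ∈ R` such that the
localised map `R[1/g] → B[1/g]` is of finite presentation. Then finitely many elements of
`ker F` generate it after inverting `g`: there is a finite `T ⊆ ker F` such that every
`y ∈ ker F` has `gᵐ y ∈ (T)` for some `m`. Proof: `A[1/g] → B[1/g]` is a surjection of finitely
presented `R`-algebras, so its kernel — the localisation of `ker F` — is finitely generated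
(Stacks, Tag 00R2); clear denominators. [cite: StacksProject, Tag 00R2 with Tag 0810 (proof, ¶1)] -/
theorem exists_finset_ker_smul_mem_span {R : Type u} [CommRing R] {A : Type v} [CommRing A]
    [Algebra R A] [Algebra.FinitePresentation R A] {B : Type*} [CommRing B] [Algebra R B]
    (F : A →ₐ[R] B) (hF : Function.Surjective F) (g : R)
    (Rg Bg : Type*) [CommRing Rg] [CommRing Bg] [Algebra R Rg] [IsLocalization.Away g Rg]
    [Algebra B Bg] [IsLocalization.Away (algebraMap R B g) Bg] (φg : Rg →+* Bg)
    (hcomp : φg.comp (algebraMap R Rg) = (algebraMap B Bg).comp (algebraMap R B))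
    (hfp : φg.FinitePresentation) :
    ∃ T : Finset A, (↑T : Set A) ⊆ RingHom.ker F.toRingHom ∧
      ∀ y ∈ RingHom.ker F.toRingHom, ∃ m : ℕ, g ^ m • y ∈ Ideal.span (↑T : Set A) := by
  classical
  set a : A := algebraMap R A g with ha
  have hFa : F a = algebraMap R B g := F.commutes g
  -- `B[1/g]` as an `R`-algebra (through `B`), finitely presented
  letI algRBg : Algebra R Bg := ((algebraMap B Bg).comp (algebraMap R B)).toAlgebra
  haveI : IsScalarTower R B Bg := IsScalarTower.of_algebraMap_eq fun _ => rfl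
  haveI : Algebra.FinitePresentation R Bg := by
    have h : ((algebraMap B Bg).comp (algebraMap R B)).FinitePresentation := by
      rw [← hcomp]
      exact hfp.comp
        (RingHom.finitePresentation_algebraMap.mpr (IsLocalization.Away.finitePresentation g))
    exact h
  -- `A[1/g]`, finitely presented over `R`
  let Ag := Localization.Away a
  haveI : Algebra.FinitePresentation A Ag := IsLocalization.Away.finitePresentation a
  haveI : Algebra.FinitePresentation R Ag := Algebra.FinitePresentation.trans R A Ag
  -- `B[1/g]` is the localisation of `B` at the image of the powers of `a`
  haveI hloc : IsLocalization ((Submonoid.powers a).map F.toRingHom) Bg := by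
    rw [Submonoid.map_powers]
    change IsLocalization (Submonoid.powers (F a)) Bg
    rw [hFa]
    infer_instance
  -- the surjection `ψ : A[1/g] → B[1/g]` of finitely presented `R`-algebras
  let ψ₀ : Ag →+* Bg := IsLocalization.map Bg F.toRingHom (Submonoid.powers a).le_comap_map
  have hψ₀ : ∀ x : A, ψ₀ (algebraMap A Ag x) = algebraMap B Bg (F x) := fun x =>
    IsLocalization.map_eq _ x
  let ψ : Ag →ₐ[R] Bg :=
    { ψ₀ with
      commutes' := fun r => by
        change ψ₀ (algebraMap R Ag r) = algebraMap B Bg (algebraMap R B r)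
        rw [IsScalarTower.algebraMap_apply R A Ag, hψ₀, F.commutes] }
  have hψsurj : Function.Surjective ψ :=
    IsLocalization.map_surjective_of_surjective (Submonoid.powers a) Ag Bg hF
  -- its kernel is finitely generated (Stacks 00R2)
  obtain ⟨s, hs⟩ := Algebra.FinitePresentation.ker_fG_of_surjective ψ hψsurj
  -- clear denominators: each generator is `x_z / aᵐ` with `aᵉ x_z ∈ ker F`
  have hgen : ∀ z : Ag, z ∈ RingHom.ker ψ.toRingHom → ∃ (y : A) (k : ℕ), y ∈ RingHom.ker F.toRingHom ∧
      z * algebraMap A Ag (a ^ k) = algebraMap A Ag y := by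
    intro z hz
    obtain ⟨⟨x, ⟨_, m, rfl⟩⟩, hx⟩ := IsLocalization.surj (Submonoid.powers a) z
    -- `F x` vanishes in `B[1/g]`, so `aᵉ x ∈ ker F`
    have hFx : algebraMap B Bg (F x) = 0 := by
      rw [← hψ₀, ← hx, map_mul]
      change ψ z * _ = 0
      rw [RingHom.mem_ker] at hz
      change ψ z = 0 at hz
      rw [hz, zero_mul]
    obtain ⟨⟨_, ⟨_, ⟨e, rfl⟩, rfl⟩⟩, hc⟩ :=
      (IsLocalization.map_eq_zero_iff ((Submonoid.powers a).map F.toRingHom) Bg (F x)).mp hFx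
    refine ⟨a ^ e * x, e + m, ?_, ?_⟩
    · rw [RingHom.mem_ker]
      change F (a ^ e * x) = 0
      rw [map_mul]
      simpa using hc
    · rw [pow_add, map_mul, map_mul, ← hx]
      ring
  choose! yz kz hyz hz using hgen
  refine ⟨s.image yz, ?_, fun y hy => ?_⟩
  · intro t ht
    obtain ⟨z, hzs, rfl⟩ := Finset.mem_image.mp ht
    exact hyz z (hs ▸ Ideal.subset_span hzs)
  · -- `y / 1 ∈ ker ψ = (s) ⊆ (T) A[1/g]`
    have hker : RingHom.ker ψ.toRingHom ≤ (Ideal.span (↑(s.image yz) : Set A)).map (algebraMap A Ag) := by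
      rw [← hs, Ideal.span_le]
      intro z hzs
      have hzk := hs ▸ Ideal.subset_span (s := (↑s : Set Ag)) hzs
      have hu : IsUnit (algebraMap A Ag (a ^ kz z)) :=
        IsLocalization.map_units Ag (⟨a ^ kz z, kz z, rfl⟩ : Submonoid.powers a)
      have hzeq : z = algebraMap A Ag (yz z) * ↑hu.unit⁻¹ := by
        rw [← hz z hzk, mul_assoc, IsUnit.mul_val_inv, mul_one]
      rw [hzeq]
      exact Ideal.mul_mem_right _ _ (Ideal.mem_map_of_mem _
        (Ideal.subset_span (Finset.mem_image_of_mem yz hzs)))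
    have hy' : algebraMap A Ag y ∈ RingHom.ker ψ.toRingHom := by
      rw [RingHom.mem_ker]
      change ψ₀ (algebraMap A Ag y) = 0
      rw [hψ₀, show F y = 0 from hy, map_zero]
    obtain ⟨⟨⟨x, hx⟩, ⟨_, k, rfl⟩⟩, hxy⟩ :=
      (IsLocalization.mem_map_algebraMap_iff (Submonoid.powers a) Ag).mp (hker hy')
    dsimp only at hxy
    have h0 : algebraMap A Ag (y * a ^ k - x) = 0 := by
      rw [map_sub, map_mul, hxy, sub_self]
    obtain ⟨⟨_, l, rfl⟩, hl⟩ := (IsLocalization.map_eq_zero_iff (Submonoid.powers a) Ag _).mp h0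
    dsimp only at hl
    refine ⟨l + k, ?_⟩
    have key : g ^ (l + k) • y = a ^ l * x := by
      rw [Algebra.smul_def, map_pow, ← ha, pow_add]
      have := sub_eq_zero.mp (by rw [← hl]; ring : a ^ l * (y * a ^ k) - a ^ l * x = 0)
      rw [← this]
      ring
    rw [key]
    exact Ideal.mul_mem_left _ _ hx

/-- **The finite finitely presented hull of a finite algebra finitely presented over an open.**
Let `φ : R → B` be a finite ring map and `g₁, …, g_s ∈ R` (indexed by a finite type) such that
the localised maps `R[1/gᵢ] → B[1/gᵢ]` (any localisations, with the compatible map) are of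
finite presentation. Then there are a finite and finitely presented ring map `ρ : R → B'` and a
surjection `π : B' → B` with `π ∘ ρ = φ` whose kernel is killed by a power of each `ρ(gᵢ)`: in
other words `Spec B → Spec B'` is a closed immersion of finite `R`-schemes which is an
isomorphism over `⋃ᵢ D(gᵢ)`, with `Spec B' → Spec R` of finite presentation.
[cite: StacksProject, Tag 0810 (proof, ¶1); RaynaudGruson1971, Première partie 5.2] -/
theorem exists_finite_finitePresentation_surjective {R B : Type u} [CommRing R] [CommRing B]
    (φ : R →+* B) (hφ : φ.Finite) {ι : Type*} [Finite ι] (g : ι → R)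
    (Rg Bg : ι → Type*) [∀ i, CommRing (Rg i)] [∀ i, CommRing (Bg i)]
    [∀ i, Algebra R (Rg i)] [∀ i, IsLocalization.Away (g i) (Rg i)]
    (algB : ∀ i, Algebra B (Bg i))
    (hBg : ∀ i, @IsLocalization.Away B _ (φ (g i)) (Bg i) _ (algB i))
    (φg : ∀ i, Rg i →+* Bg i)
    (hcomp : ∀ i, (φg i).comp (algebraMap R (Rg i)) = (@algebraMap B (Bg i) _ _ (algB i)).comp φ)
    (hfp : ∀ i, (φg i).FinitePresentation) :
    ∃ (B' : Type u) (_ : CommRing B') (ρ : R →+* B') (π : B' →+* B),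
      ρ.Finite ∧ ρ.FinitePresentation ∧ Function.Surjective π ∧ π.comp ρ = φ ∧
      ∀ i, ∀ y ∈ RingHom.ker π, ∃ m : ℕ, ρ (g i) ^ m * y = 0 := by
  classical
  letI := φ.toAlgebra
  haveI : Module.Finite R B := hφ
  -- a presentation `F : R[x₁, …, xₙ] → B`
  obtain ⟨n, F, hF⟩ := Algebra.FiniteType.iff_quotient_mvPolynomial''.mp
    (inferInstance : Algebra.FiniteType R B)
  -- monic relations
  obtain ⟨J₀, hJ₀fg, hJ₀, hfin⟩ := exists_fg_le_ker_finite_quotient F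
  -- relations generating the kernel over each `D(gᵢ)`
  have hT : ∀ i, ∃ T : Finset (MvPolynomial (Fin n) R),
      (↑T : Set (MvPolynomial (Fin n) R)) ⊆ RingHom.ker F.toRingHom ∧
      ∀ y ∈ RingHom.ker F.toRingHom, ∃ m : ℕ, g i ^ m • y ∈ Ideal.span (↑T : Set _) := fun i =>
    letI := algB i
    haveI := hBg i
    exists_finset_ker_smul_mem_span F hF (g i) (Rg i) (Bg i) (φg i) (hcomp i) (hfp i)
  choose T hTker hTgen using hT
  haveI : Fintype ι := Fintype.ofFinite ι
  let J₁ : Ideal (MvPolynomial (Fin n) R) := J₀ ⊔ ⨆ i, Ideal.span (↑(T i) : Set _)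
  have hJ₁ker : J₁ ≤ RingHom.ker F.toRingHom :=
    sup_le hJ₀ (iSup_le fun i => Ideal.span_le.mpr (hTker i))
  have hJ₁fg : J₁.FG := by
    refine Submodule.FG.sup hJ₀fg ?_
    have : (⨆ i, Ideal.span (↑(T i) : Set (MvPolynomial (Fin n) R))) =
        Ideal.span (↑(Finset.univ.biUnion T) : Set _) := by
      rw [Finset.coe_biUnion, Ideal.span_iUnion]
      simp
    rw [this]
    exact ⟨_, rfl⟩
  haveI : Module.Finite R (MvPolynomial (Fin n) R ⧸ J₁) := hfin J₁ le_sup_left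
  haveI : Algebra.FinitePresentation R (MvPolynomial (Fin n) R ⧸ J₁) :=
    Algebra.FinitePresentation.quotient hJ₁fg
  let π : MvPolynomial (Fin n) R ⧸ J₁ →ₐ[R] B := Ideal.Quotient.liftₐ J₁ F
    (fun a ha => hJ₁ker ha)
  refine ⟨MvPolynomial (Fin n) R ⧸ J₁, inferInstance, algebraMap R _, π.toRingHom,
    RingHom.finite_algebraMap.mpr inferInstance,
    RingHom.finitePresentation_algebraMap.mpr inferInstance, ?_, ?_, fun i y hy => ?_⟩
  · intro b
    obtain ⟨a, rfl⟩ := hF b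
    exact ⟨Ideal.Quotient.mk J₁ a, rfl⟩
  · ext r
    exact π.commutes r
  · obtain ⟨a, rfl⟩ := Ideal.Quotient.mk_surjective y
    have ha : a ∈ RingHom.ker F.toRingHom := by
      rw [RingHom.mem_ker] at hy ⊢
      exact hy
    obtain ⟨m, hm⟩ := hTgen i a ha
    refine ⟨m, ?_⟩
    rw [IsScalarTower.algebraMap_apply R (MvPolynomial (Fin n) R) (MvPolynomial (Fin n) R ⧸ J₁),
      Ideal.Quotient.algebraMap_eq, ← map_pow, ← map_mul, Ideal.Quotient.eq_zero_iff_mem]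
    refine le_sup_right (a := J₀) (Ideal.mem_iSup_of_mem i ?_)
    rwa [Algebra.smul_def, map_pow] at hm

end Literature.RingTheory.Localization
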